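import Mathlib
import Summits.Ventures.HodgeRepro2.LevelPositivity

/-!
# T6B5DirectSum — Tier 6, sub-goal B5: Lemma B5.7 for Mathlib's `Representation.directSum`

TIER4 §B5 Lemma B5.7 («invariants of direct sums; the count»): for a family of `ℂ[K]`-modules
`(⊕_β W_β)^K = ⊕_β W_β^K` and `dim (⊕_β W_β)^K = Σ_β dim W_β^K`. The accepted kernel proves it for finite
products (`LevelInvariantsCount.finrank_invariants_piRep`, p388821); Liu's Thm. 4.18 is displayed over the direct
sum over ALL pairs `(ε, χ)` (`Representation.directSum`), so the count is needed in the `finsum` form of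
Cor. 4.20's `d(μ, K)` under the printed finiteness («the integer d(μ, K)»). Nothing arithmetic: `k` any field.
README §8(d): uses an L-value-free non-vanishing device: NO.
-/

namespace Summit.Ventures.HodgeRepro2.T6.B5DirectSum

open Summit.Ventures.HodgeRepro2.LevelPositivity DirectSum Module

variable {G : Type*} [Group G] {k : Type*} [Field k] {J : Type*} {W : J → Type*}
  [∀ j, AddCommGroup (W j)] [∀ j, Module k (W j)]
  (ω : ∀ j, Representation k G (W j)) (K : Subgroup G)

/-- Lemma B5.7 (membership): a vector of `⨁ j, W j` is `K`-invariant for the direct-sum representation iff each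
of its components is `K`-invariant. -/
theorem mem_invariants_directSum_iff {x : ⨁ j, W j} :
    x ∈ invariants (Representation.directSum ω) K ↔ ∀ j, x j ∈ invariants (ω j) K := by
  simp only [mem_invariants_iff, Representation.directSum_apply]
  constructor
  · intro h j g hg
    have := congrArg (fun y : ⨁ j, W j => y j) (h g hg)
    simpa using this
  · intro h g hg
    ext j
    simp [h j g hg]

/-- The inclusion `⨁ j, (W j)^K → ⨁ j, W j`. -/
noncomputable def incl : (⨁ j, invariants (ω j) K) →ₗ[k] ⨁ j, W j :=
  DirectSum.lmap fun j => (invariants (ω j) K).subtype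

/-- The inclusion is componentwise the subtype map. -/
theorem incl_apply (y : ⨁ j, invariants (ω j) K) (j : J) : incl ω K y j = (y j : W j) := rfl

/-- The inclusion `⨁ j, (W j)^K → ⨁ j, W j` is injective. -/
theorem incl_injective : Function.Injective (incl ω K) :=
  (DirectSum.lmap_injective _).2 fun j => (invariants (ω j) K).injective_subtype

/-- Lemma B5.7: the image of `⨁ j, (W j)^K` in `⨁ j, W j` is exactly `(⨁ j, W j)^K`. -/
theorem range_incl : LinearMap.range (incl ω K) = invariants (Representation.directSum ω) K := by
  classical
  ext x
  constructor
  · rintro ⟨y, rfl⟩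
    rw [mem_invariants_directSum_iff]
    intro j
    rw [incl_apply]
    exact (y j).2
  · intro hx
    rw [mem_invariants_directSum_iff] at hx
    refine ⟨DFinsupp.mk x.support (fun j => ⟨x j.1, hx j.1⟩), ?_⟩
    ext j
    rw [incl_apply, DFinsupp.mk_apply]
    split_ifs with h
    · rfl
    · exact (DFinsupp.notMem_support_iff.1 h).symm

/-- Lemma B5.7 as a linear equivalence `⨁ j, (W j)^K ≃ (⨁ j, W j)^K`. -/
noncomputable def invariantsDirectSumEquiv :
    (⨁ j, invariants (ω j) K) ≃ₗ[k] invariants (Representation.directSum ω) K :=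
  (LinearEquiv.ofInjective (incl ω K) (incl_injective ω K)).trans (LinearEquiv.ofEq _ _ (range_incl ω K))

/-- `dim (⨁ W_j)^K = dim ⨁ (W_j)^K`. -/
theorem finrank_invariants_directSum_eq :
    finrank k (invariants (Representation.directSum ω) K) = finrank k (⨁ j, invariants (ω j) K) :=
  (LinearEquiv.finrank_eq (invariantsDirectSumEquiv ω K)).symm

/-- The dimension of a direct sum of finite-dimensional spaces, finitely many of them non-zero, is the (finite) sum
of the dimensions. -/
theorem finrank_directSum_of_support_finite {N : J → Type*} [∀ j, AddCommGroup (N j)] [∀ j, Module k (N j)]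
    [∀ j, FiniteDimensional k (N j)] (hfin : (Function.support fun j => finrank k (N j)).Finite) :
    finrank k (⨁ j, N j) = ∑ᶠ j, finrank k (N j) := by
  classical
  let b : Basis (Σ j, Fin (finrank k (N j))) k (⨁ j, N j) :=
    DFinsupp.basis fun j => Module.finBasis k (N j)
  rw [Module.finrank_eq_nat_card_basis b]
  let S : Finset J := hfin.toFinset
  have hS : ∀ j, finrank k (N j) ≠ 0 → j ∈ S := fun j hj => by
    simp only [S, Set.Finite.mem_toFinset, Function.mem_support]
    exact hj
  let e : (Σ j, Fin (finrank k (N j))) ≃ (Σ j : S, Fin (finrank k (N j.1))) :=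
    { toFun := fun x => ⟨⟨x.1, hS x.1 (Nat.pos_iff_ne_zero.mp x.2.pos)⟩, x.2⟩
      invFun := fun y => ⟨y.1.1, y.2⟩
      left_inv := fun _ => rfl
      right_inv := fun _ => rfl }
  rw [Nat.card_congr e, Nat.card_eq_fintype_card, Fintype.card_sigma]
  simp only [Fintype.card_fin]
  rw [finsum_eq_sum_of_support_subset (fun j => finrank k (N j)) (s := S)
    (fun j hj => hS j (Function.mem_support.1 hj))]
  exact Finset.sum_coe_sort S fun j => finrank k (N j)

/-- Lemma B5.7, the count in Cor. 4.20's form: `dim_k (⊕_j W_j)^K = Σᶠ_j dim_k (W_j)^K` when every `(W_j)^K` is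
finite-dimensional (admissibility) and only finitely many are non-zero («the integer d(μ, K)»). -/
theorem finrank_invariants_directSum [∀ j, FiniteDimensional k (invariants (ω j) K)]
    (hfin : (Function.support fun j => finrank k (invariants (ω j) K)).Finite) :
    finrank k (invariants (Representation.directSum ω) K) = ∑ᶠ j, finrank k (invariants (ω j) K) := by
  rw [finrank_invariants_directSum_eq, finrank_directSum_of_support_finite hfin]

/-- Step 4 of TIER4 Theorem B5.1 in `finsum` form: the count is antitone in the level
(`LevelPositivity.sum_finrank_invariants_mono` is the finite-sum form). -/
theorem finsum_finrank_invariants_mono {K K' : Subgroup G} (h : K' ≤ K)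
    [∀ j, FiniteDimensional k (invariants (ω j) K')]
    (hfin' : (Function.support fun j => finrank k (invariants (ω j) K')).Finite) :
    ∑ᶠ j, finrank k (invariants (ω j) K) ≤ ∑ᶠ j, finrank k (invariants (ω j) K') := by
  have hle : ∀ j, finrank k (invariants (ω j) K) ≤ finrank k (invariants (ω j) K') := fun j =>
    Submodule.finrank_mono (invariants_mono h)
  refine finsum_le_finsum' ?_ hfin' hle
  refine hfin'.subset ?_
  intro j hj
  simp only [Function.mem_support] at hj ⊢
  intro h0
  exact hj (Nat.le_zero.mp (h0 ▸ hle j))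

end Summit.Ventures.HodgeRepro2.T6.B5DirectSum
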